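import Mathlib
import Literature.MathematicalPhysics.AQFT.OffDiagonalFlatDecay
import Literature.MathematicalPhysics.QuantumLattice.SchwartzTensor
import HarnessLib

/-!
# Smooth cutoffs of tensor test functions (support file for `StrongCouplingIRTrivial`)

Route `InfraredLiouville` of `YangMills`, support item `stmt-QuantumFields-9708`
(`Summit.QuantumFields.YangMills.Theses.InfraredLiouville.StrongCouplingIRTrivial`).

The item asks that the two-point Schwinger functions of every infrared scaling limit of the
strong-coupling lattice Yang–Mills theory vanish on off-diagonal tensors `F = f₀ ⊗ f₁ ∈ ⁰𝒮`.
The lattice approximants converge to `𝔖₂(F)` for EVERY such tensor, but a direct estimate of the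
approximant is only available when the factors `fᵢ` have compact support (on the torus, sites
near opposite faces of the fundamental domain are neighbours, so the Schwartz tails of `f₀`, `f₁`
see an `O(1)` covariance). The reduction to compact support is the content of this file:

* `bump`, `bumpPi` — a fixed smooth bump on `E` (`= 1` on the unit ball, `= 0` outside the ball
  of radius `2`) and its tensor power `x ↦ ∏ᵢ bump (xᵢ)` on `Fin n → E` (complex-valued);
* `norm_iteratedFDeriv_comp_inv_smul_le` — derivatives of `x ↦ Φ (R⁻¹ • x)` are `O(R⁻ⁱ)`;
* `cutoffTest R f = bump (R⁻¹ • ·) · f ∈ 𝓢(E, ℝ)` (Mathlib `SchwartzMap.smulLeftCLM`), supported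
  in the closed ball of radius `2R`;
* `cutoffTensor R f = ⊗ᵢ cutoffTest R fᵢ`, a tensor (`IsTensorOf`) which is again off-diagonal
  when `⊗ᵢ fᵢ` is (`IsOffDiagonal.cutoffTensor`, Leibniz bound with vanishing jets);
* `seminorm_cutoffTensor_sub_le` — `‖cutoffTensor R f − F‖_{k,l} ≤ C_{k,l} / R` for `R ≥ 1`, whence
  `tendsto_cutoffTensor`: `cutoffTensor R f → F` in the Schwartz topology as `R → ∞`.

Everything is elementary (Mathlib: `ContDiffBump`, `norm_iteratedFDeriv_mul_le`,
`ContinuousLinearMap.iteratedFDeriv_comp_right`, `schwartz_withSeminorms`); no named facts.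
-/

noncomputable section

open scoped SchwartzMap ContDiff Topology BigOperators
open Filter Set Literature.MathematicalPhysics.AQFT Literature.MathematicalPhysics.QuantumLattice

namespace Summit.QuantumFields.YangMills.Theorems.StrongCouplingIRTrivial

/-! ### Scaling a smooth function with bounded derivatives -/

section Scaling

variable {D V : Type*} [NormedAddCommGroup D] [NormedSpace ℝ D] [NormedAddCommGroup V]
  [NormedSpace ℝ V]

/-- Chain rule for the dilation `x ↦ R⁻¹ • x`: if `‖Dⁱ Φ‖ ≤ A` everywhere then
`‖Dⁱ (Φ (R⁻¹ • ·)) x‖ ≤ A · R⁻ⁱ` (`R > 0`). [folklore] -/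
theorem norm_iteratedFDeriv_comp_inv_smul_le {Φ : D → V} (hΦ : ContDiff ℝ ∞ Φ) {i : ℕ} {A : ℝ}
    (hA : ∀ x, ‖iteratedFDeriv ℝ i Φ x‖ ≤ A) {R : ℝ} (hR : 0 < R) (x : D) :
    ‖iteratedFDeriv ℝ i (fun y => Φ (R⁻¹ • y)) x‖ ≤ A * R⁻¹ ^ i := by
  have hg : (fun y => Φ (R⁻¹ • y)) = Φ ∘ (R⁻¹ • ContinuousLinearMap.id ℝ D) := rfl
  rw [hg, ContinuousLinearMap.iteratedFDeriv_comp_right _ hΦ x (mod_cast le_top)]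
  refine (ContinuousMultilinearMap.norm_compContinuousLinearMap_le _ _).trans ?_
  have hA0 : 0 ≤ A := (norm_nonneg _).trans (hA 0)
  rw [Finset.prod_const, Finset.card_univ, Fintype.card_fin]
  refine mul_le_mul (hA _) ?_ (by positivity) hA0
  refine pow_le_pow_left₀ (norm_nonneg _) ?_ i
  rw [norm_smul, Real.norm_eq_abs, abs_of_pos (inv_pos.2 hR)]
  calc R⁻¹ * ‖ContinuousLinearMap.id ℝ D‖ ≤ R⁻¹ * 1 :=
        mul_le_mul_of_nonneg_left ContinuousLinearMap.norm_id_le (inv_pos.2 hR).le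
    _ = R⁻¹ := mul_one _

/-- A smooth compactly supported function has bounded derivatives of every order. [folklore] -/
theorem exists_norm_iteratedFDeriv_le {Φ : D → V} (hΦ : ContDiff ℝ ∞ Φ)
    (hc : HasCompactSupport Φ) (i : ℕ) : ∃ A, ∀ x, ‖iteratedFDeriv ℝ i Φ x‖ ≤ A := by
  have hcont : Continuous fun x => ‖iteratedFDeriv ℝ i Φ x‖ :=
    (hΦ.continuous_iteratedFDeriv (mod_cast le_top)).norm
  obtain ⟨A, hA⟩ := hcont.bddAbove_range_of_hasCompactSupport (hc.iteratedFDeriv i).norm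
  exact ⟨A, fun x => hA ⟨x, rfl⟩⟩

end Scaling

/-! ### The bump and its tensor power -/

section Bump

variable {E : Type*} [NormedAddCommGroup E] [NormedSpace ℝ E] [HasContDiffBump E]

/-- A fixed smooth bump centred at `0`: equal to `1` on the closed unit ball, vanishing outside
the ball of radius `2`, with values in `[0, 1]` (Mathlib `ContDiffBump`). [folklore] -/
def bump : ContDiffBump (0 : E) := ⟨1, 2, one_pos, one_lt_two⟩

/-- `bump x = 1` for `‖x‖ ≤ 1`. [folklore] -/
theorem bump_apply_of_norm_le {x : E} (h : ‖x‖ ≤ 1) : (bump : ContDiffBump (0 : E)) x = 1 :=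
  bump.one_of_mem_closedBall (by simpa [bump] using h)

/-- `bump x = 0` for `2 ≤ ‖x‖`. [folklore] -/
theorem bump_apply_of_two_le_norm {x : E} (h : 2 ≤ ‖x‖) : (bump : ContDiffBump (0 : E)) x = 0 :=
  bump.zero_of_le_dist (by simpa [bump] using h)

variable {n : ℕ}

/-- The complexified tensor power of the bump, `bumpPi x = ∏ᵢ bump (xᵢ)` on `Fin n → E`.
[folklore] -/
def bumpPi (x : Fin n → E) : ℂ := ((∏ i, (bump : ContDiffBump (0 : E)) (x i) : ℝ) : ℂ)

/-- `bumpPi x = 1` on the closed unit ball (sup norm). [folklore] -/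
theorem bumpPi_apply_of_norm_le {x : Fin n → E} (h : ‖x‖ ≤ 1) : bumpPi x = 1 := by
  have h1 : ∀ i, (bump : ContDiffBump (0 : E)) (x i) = 1 := fun i =>
    bump_apply_of_norm_le ((norm_le_pi_norm x i).trans h)
  simp [bumpPi, h1]

/-- `bumpPi x = 0` outside the closed ball of radius `2`. [folklore] -/
theorem bumpPi_apply_of_two_lt_norm {x : Fin n → E} (h : 2 < ‖x‖) : bumpPi x = 0 := by
  have h' : ¬ ∀ i, ‖x i‖ ≤ 2 := fun h' =>
    (not_lt.2 ((pi_norm_le_iff_of_nonneg (by norm_num)).2 h')) h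
  push Not at h'
  obtain ⟨i, hi⟩ := h'
  have h0 : (bump : ContDiffBump (0 : E)) (x i) = 0 := bump_apply_of_two_le_norm hi.le
  unfold bumpPi
  rw [Finset.prod_eq_zero (Finset.mem_univ i) h0, Complex.ofReal_zero]

/-- `‖bumpPi x‖ ≤ 1`. [folklore] -/
theorem norm_bumpPi_le (x : Fin n → E) : ‖bumpPi x‖ ≤ 1 := by
  unfold bumpPi
  rw [Complex.norm_real, Real.norm_eq_abs, Finset.abs_prod]
  refine Finset.prod_le_one (fun i _ => abs_nonneg _) fun i _ => ?_
  rw [abs_of_nonneg bump.nonneg]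
  exact bump.le_one

/-- `bumpPi` is smooth. [folklore] -/
theorem contDiff_bumpPi : ContDiff ℝ ∞ (bumpPi (E := E) (n := n)) := by
  unfold bumpPi
  have h : ContDiff ℝ ∞ fun x : Fin n → E => ∏ i ∈ Finset.univ, (bump : ContDiffBump (0 : E)) (x i) :=
    contDiff_prod fun i _ => bump.contDiff.comp (contDiff_apply ℝ E i)
  exact Complex.ofRealCLM.contDiff.comp h

/-- `bumpPi` has compact support (finite-dimensional `E`). [folklore] -/
theorem hasCompactSupport_bumpPi [FiniteDimensional ℝ E] :
    HasCompactSupport (bumpPi (E := E) (n := n)) := by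
  refine HasCompactSupport.intro (isCompact_closedBall (0 : Fin n → E) 2) fun x hx => ?_
  refine bumpPi_apply_of_two_lt_norm ?_
  simpa [Metric.mem_closedBall, dist_zero_right] using hx

/-- Uniform bounds `A i` on the derivatives of `bumpPi`. [folklore] -/
theorem exists_norm_iteratedFDeriv_bumpPi_le [FiniteDimensional ℝ E] (i : ℕ) :
    ∃ A, ∀ x : Fin n → E, ‖iteratedFDeriv ℝ i bumpPi x‖ ≤ A :=
  exists_norm_iteratedFDeriv_le contDiff_bumpPi hasCompactSupport_bumpPi i

/-! ### Cutoff test functions -/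

/-- The scaled cutoff `x ↦ bump (R⁻¹ • x)` (`= 1` on the ball of radius `R`, `= 0` outside the
ball of radius `2R`). [folklore] -/
def cutoff (R : ℝ) (x : E) : ℝ := (bump : ContDiffBump (0 : E)) (R⁻¹ • x)

/-- `cutoff R x = 0` for `2R ≤ ‖x‖` (`R > 0`). [folklore] -/
theorem cutoff_eq_zero {R : ℝ} (hR : 0 < R) {x : E} (h : 2 * R ≤ ‖x‖) : cutoff R x = 0 := by
  refine bump_apply_of_two_le_norm ?_
  rw [norm_smul, Real.norm_eq_abs, abs_of_pos (inv_pos.2 hR), le_inv_mul_iff₀ hR]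
  linarith

/-- The cutoff has temperate growth (it is smooth with compact support, composed with a linear
map). [folklore] -/
theorem hasTemperateGrowth_cutoff [FiniteDimensional ℝ E] (R : ℝ) :
    (cutoff (E := E) R).HasTemperateGrowth := by
  have h : cutoff (E := E) R =
      (bump : ContDiffBump (0 : E)) ∘ (R⁻¹ • ContinuousLinearMap.id ℝ E) := rfl
  rw [h]
  exact (bump.hasCompactSupport.hasTemperateGrowth bump.contDiff).comp
    (R⁻¹ • ContinuousLinearMap.id ℝ E).hasTemperateGrowth

variable [FiniteDimensional ℝ E]

/-- The cut-off test function `cutoffTest R f = cutoff R · f ∈ 𝓢(E, ℝ)`. [folklore] -/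
def cutoffTest (R : ℝ) (f : 𝓢(E, ℝ)) : 𝓢(E, ℝ) := SchwartzMap.smulLeftCLM ℝ (cutoff R) f

/-- Pointwise formula for `cutoffTest`. [folklore] -/
@[simp] theorem cutoffTest_apply (R : ℝ) (f : 𝓢(E, ℝ)) (x : E) :
    cutoffTest R f x = cutoff R x * f x := by
  rw [cutoffTest, SchwartzMap.smulLeftCLM_apply_apply (hasTemperateGrowth_cutoff R), smul_eq_mul]

/-- `cutoffTest R f` is supported in the closed ball of radius `2R`. [folklore] -/
theorem norm_le_of_cutoffTest_ne_zero {R : ℝ} (hR : 0 < R) {f : 𝓢(E, ℝ)} {x : E}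
    (h : cutoffTest R f x ≠ 0) : ‖x‖ ≤ 2 * R := by
  by_contra hx
  rw [cutoffTest_apply, cutoff_eq_zero hR (not_le.1 hx).le, zero_mul] at h
  exact h rfl

/-- The cut-off tensor `cutoffTensor R f = ⊗ᵢ (cutoff R · fᵢ)` (complexified), built with the
tree's `SchwartzMap.tensorFin`. [folklore] -/
def cutoffTensor (R : ℝ) (f : Fin n → 𝓢(E, ℝ)) : 𝓢((Fin n → E), ℂ) :=
  SchwartzMap.tensorFin n fun i => ofRealTest (cutoffTest R (f i))

omit [FiniteDimensional ℝ E] in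
/-- `cutoffTensor R f` is the tensor product of the cut-off factors. [folklore] -/
theorem isTensorOf_cutoffTensor (R : ℝ) (f : Fin n → 𝓢(E, ℝ)) :
    IsTensorOf (cutoffTensor R f) fun i => ofRealTest (cutoffTest R (f i)) :=
  isTensorOf_tensorFin _

/-- Pointwise: `cutoffTensor R f x = bumpPi (R⁻¹ • x) · F x` for any tensor `F = ⊗ᵢ fᵢ`.
[folklore] -/
theorem cutoffTensor_apply {R : ℝ} {f : Fin n → 𝓢(E, ℝ)} {F : 𝓢((Fin n → E), ℂ)}
    (hF : IsTensorOf F fun i => ofRealTest (f i)) (x : Fin n → E) :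
    cutoffTensor R f x = bumpPi (R⁻¹ • x) * F x := by
  rw [isTensorOf_cutoffTensor R f x, hF x]
  simp only [ofRealTest_apply, cutoffTest_apply, Complex.ofReal_mul, Finset.prod_mul_distrib,
    bumpPi, Complex.ofReal_prod, cutoff, Pi.smul_apply]

omit [FiniteDimensional ℝ E] in
/-- The function `x ↦ bumpPi (R⁻¹ • x)` is smooth. [folklore] -/
theorem contDiff_bumpPi_comp_smul (R : ℝ) :
    ContDiff ℝ ∞ fun x : Fin n → E => bumpPi (R⁻¹ • x) :=
  contDiff_bumpPi.comp (contDiff_const_smul R⁻¹)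

/-- **Cut-off tensors stay in `⁰𝒮`.** If `F = ⊗ᵢ fᵢ` is off-diagonal then so is
`cutoffTensor R f` (Leibniz bound for `bumpPi (R⁻¹ • ·) · F` at a coincident point, where every
derivative of `F` vanishes). [folklore] -/
theorem isOffDiagonal_cutoffTensor
    {f : Fin n → 𝓢(E, ℝ)} {F : 𝓢((Fin n → E), ℂ)} (hO : IsOffDiagonal F)
    (hF : IsTensorOf F fun i => ofRealTest (f i)) (R : ℝ) : IsOffDiagonal (cutoffTensor R f) := by
  intro z hz k
  have hfun : ⇑(cutoffTensor R f) = fun x => bumpPi (R⁻¹ • x) * F x :=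
    funext (cutoffTensor_apply hF)
  rw [hfun]
  have h := norm_iteratedFDeriv_mul_le (contDiff_bumpPi_comp_smul R) (F.smooth ⊤) z (n := k)
    (mod_cast le_top)
  have h0 : ∑ i ∈ Finset.range (k + 1), (k.choose i : ℝ) *
      ‖iteratedFDeriv ℝ i (fun x : Fin n → E => bumpPi (R⁻¹ • x)) z‖ *
        ‖iteratedFDeriv ℝ (k - i) F z‖ = 0 :=
    Finset.sum_eq_zero fun i _ => by rw [hO z hz (k - i), norm_zero, mul_zero]
  exact norm_le_zero_iff.1 (h.trans_eq h0)

/-! ### The Schwartz tail of the cutoff -/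

/-- Pointwise bound behind the tail estimate: for `R ≥ 1`, `θ_R = bumpPi (R⁻¹ • ·) − 1` and
`F ∈ 𝓢`, `‖x‖ᵏ ‖Dˡ(θ_R F)(x)‖ ≤ C / R` with `C` independent of `R` and `x`. [folklore] -/
theorem exists_bound_tail (F : 𝓢((Fin n → E), ℂ)) (k l : ℕ) :
    ∃ C : ℝ, 0 ≤ C ∧ ∀ R : ℝ, 1 ≤ R → ∀ x : Fin n → E,
      ‖x‖ ^ k * ‖iteratedFDeriv ℝ l (fun y => (bumpPi (R⁻¹ • y) - 1) * F y) x‖ ≤ C / R := by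
  -- derivative bounds for `bumpPi`
  choose A hA using fun i => exists_norm_iteratedFDeriv_bumpPi_le (E := E) (n := n) i
  have hA0 : ∀ i, 0 ≤ A i := fun i => (norm_nonneg _).trans (hA i 0)
  -- the constant
  set C : ℝ := 2 * SchwartzMap.seminorm ℂ (k + 1) l F +
    ∑ i ∈ Finset.range l, (l.choose (i + 1) : ℝ) * A (i + 1) * SchwartzMap.seminorm ℂ k (l - (i + 1)) F
    with hC
  have hC0 : 0 ≤ C := by
    rw [hC]
    refine add_nonneg (by positivity) (Finset.sum_nonneg fun i _ => ?_)
    have := hA0 (i + 1)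
    positivity
  refine ⟨C, hC0, fun R hR x => ?_⟩
  have hR0 : 0 < R := one_pos.trans_le hR
  set θ : (Fin n → E) → ℂ := fun y => bumpPi (R⁻¹ • y) - 1 with hθ
  have hθs : ContDiff ℝ ∞ θ := (contDiff_bumpPi_comp_smul R).sub contDiff_const
  -- bounds on the derivatives of `θ`
  have hθ0 : ∀ y, ‖iteratedFDeriv ℝ 0 θ y‖ ≤ 2 := fun y => by
    rw [norm_iteratedFDeriv_zero, hθ]
    calc ‖bumpPi (R⁻¹ • y) - 1‖ ≤ ‖bumpPi (R⁻¹ • y)‖ + ‖(1 : ℂ)‖ := norm_sub_le _ _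
      _ ≤ 1 + 1 := add_le_add (norm_bumpPi_le _) (by simp)
      _ = 2 := by norm_num
  have hθ0' : ∀ y : Fin n → E, ‖y‖ ≤ R → iteratedFDeriv ℝ 0 θ y = 0 := fun y hy => by
    have h1 : ‖R⁻¹ • y‖ ≤ 1 := by
      rw [norm_smul, Real.norm_eq_abs, abs_of_pos (inv_pos.2 hR0), inv_mul_le_iff₀ hR0, mul_one]
      exact hy
    ext v
    simp only [iteratedFDeriv_zero_apply, zero_apply, hθ,
      bumpPi_apply_of_norm_le h1, sub_self]
  have hθi : ∀ i, 1 ≤ i → ∀ y, ‖iteratedFDeriv ℝ i θ y‖ ≤ A i / R := fun i hi y => by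
    have hsplit : θ = (fun y => bumpPi (R⁻¹ • y)) + fun _ => (-1 : ℂ) := by
      funext y; simp [hθ, sub_eq_add_neg]
    rw [hsplit, iteratedFDeriv_add_apply
      (((contDiff_bumpPi_comp_smul R).of_le (mod_cast le_top)).contDiffAt)
      contDiff_const.contDiffAt, iteratedFDeriv_const_of_ne (by omega), Pi.zero_apply,
      add_zero]
    refine (norm_iteratedFDeriv_comp_inv_smul_le contDiff_bumpPi (hA i) hR0 y).trans ?_
    rw [div_eq_mul_inv]
    refine mul_le_mul_of_nonneg_left ?_ (hA0 i)
    calc R⁻¹ ^ i ≤ R⁻¹ ^ 1 := pow_le_pow_of_le_one (inv_pos.2 hR0).le (inv_le_one_of_one_le₀ hR) hi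
      _ = R⁻¹ := pow_one _
  -- Leibniz
  have hL := norm_iteratedFDeriv_mul_le hθs (F.smooth ⊤) x (n := l) (mod_cast le_top)
  have hxk : 0 ≤ ‖x‖ ^ k := by positivity
  -- the `i = 0` term: zero inside the ball of radius `R`, one extra power of `‖x‖` outside
  have hterm0 : ‖iteratedFDeriv ℝ 0 θ x‖ * (‖x‖ ^ k * ‖iteratedFDeriv ℝ l F x‖) ≤
      2 * SchwartzMap.seminorm ℂ (k + 1) l F / R := by
    by_cases hx : ‖x‖ ≤ R
    · rw [hθ0' x hx, norm_zero, zero_mul]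
      positivity
    · have hRx : R < ‖x‖ := not_le.1 hx
      have key : ‖x‖ ^ k * ‖iteratedFDeriv ℝ l F x‖ ≤
          SchwartzMap.seminorm ℂ (k + 1) l F / R := by
        rw [le_div_iff₀ hR0]
        calc ‖x‖ ^ k * ‖iteratedFDeriv ℝ l F x‖ * R
            ≤ ‖x‖ ^ k * ‖iteratedFDeriv ℝ l F x‖ * ‖x‖ :=
              mul_le_mul_of_nonneg_left hRx.le (by positivity)
          _ = ‖x‖ ^ (k + 1) * ‖iteratedFDeriv ℝ l F x‖ := by ring
          _ ≤ SchwartzMap.seminorm ℂ (k + 1) l F := SchwartzMap.le_seminorm ℂ _ _ F x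
      calc ‖iteratedFDeriv ℝ 0 θ x‖ * (‖x‖ ^ k * ‖iteratedFDeriv ℝ l F x‖)
          ≤ 2 * (SchwartzMap.seminorm ℂ (k + 1) l F / R) :=
            mul_le_mul (hθ0 x) key (by positivity) (by norm_num)
        _ = _ := by ring
  -- the `i ≥ 1` terms
  have hterm : ∀ i ∈ Finset.range l,
      (l.choose (i + 1) : ℝ) * ‖iteratedFDeriv ℝ (i + 1) θ x‖ *
          (‖x‖ ^ k * ‖iteratedFDeriv ℝ (l - (i + 1)) F x‖) ≤
        (l.choose (i + 1) : ℝ) * (A (i + 1) / R) * SchwartzMap.seminorm ℂ k (l - (i + 1)) F := by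
    intro i _
    have h1 := hθi (i + 1) (by omega) x
    have h2 : ‖x‖ ^ k * ‖iteratedFDeriv ℝ (l - (i + 1)) F x‖ ≤
        SchwartzMap.seminorm ℂ k (l - (i + 1)) F := SchwartzMap.le_seminorm ℂ _ _ F x
    have h3 : 0 ≤ A (i + 1) / R := div_nonneg (hA0 _) hR0.le
    gcongr
  calc ‖x‖ ^ k * ‖iteratedFDeriv ℝ l (fun y => θ y * F y) x‖
      ≤ ‖x‖ ^ k * ∑ i ∈ Finset.range (l + 1), (l.choose i : ℝ) * ‖iteratedFDeriv ℝ i θ x‖ *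
          ‖iteratedFDeriv ℝ (l - i) F x‖ := mul_le_mul_of_nonneg_left hL hxk
    _ = ∑ i ∈ Finset.range (l + 1), (l.choose i : ℝ) * ‖iteratedFDeriv ℝ i θ x‖ *
          (‖x‖ ^ k * ‖iteratedFDeriv ℝ (l - i) F x‖) := by
        rw [Finset.mul_sum]
        exact Finset.sum_congr rfl fun i _ => by ring
    _ = (∑ i ∈ Finset.range l, (l.choose (i + 1) : ℝ) * ‖iteratedFDeriv ℝ (i + 1) θ x‖ *
          (‖x‖ ^ k * ‖iteratedFDeriv ℝ (l - (i + 1)) F x‖)) +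
          ‖iteratedFDeriv ℝ 0 θ x‖ * (‖x‖ ^ k * ‖iteratedFDeriv ℝ l F x‖) := by
        rw [Finset.sum_range_succ', Nat.choose_zero_right, Nat.cast_one, one_mul, Nat.sub_zero]
    _ ≤ (∑ i ∈ Finset.range l, (l.choose (i + 1) : ℝ) * (A (i + 1) / R) *
          SchwartzMap.seminorm ℂ k (l - (i + 1)) F) +
          2 * SchwartzMap.seminorm ℂ (k + 1) l F / R :=
        add_le_add (Finset.sum_le_sum hterm) hterm0
    _ = C / R := by
        rw [hC, add_div, Finset.sum_div, add_comm]
        congr 1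
        exact Finset.sum_congr rfl fun i _ => by ring

/-- **Tail estimate.** For a tensor `F = ⊗ᵢ fᵢ` and every Schwartz seminorm,
`‖cutoffTensor R f − F‖_{k,l} ≤ C_{k,l} / R` for `R ≥ 1`. [folklore] -/
theorem seminorm_cutoffTensor_sub_le {f : Fin n → 𝓢(E, ℝ)} {F : 𝓢((Fin n → E), ℂ)}
    (hF : IsTensorOf F fun i => ofRealTest (f i)) (k l : ℕ) :
    ∃ C : ℝ, 0 ≤ C ∧ ∀ R : ℝ, 1 ≤ R →
      SchwartzMap.seminorm ℂ k l (cutoffTensor R f - F) ≤ C / R := by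
  obtain ⟨C, hC0, hC⟩ := exists_bound_tail F k l
  refine ⟨C, hC0, fun R hR => SchwartzMap.seminorm_le_bound ℂ k l _
    (div_nonneg hC0 (zero_le_one.trans hR)) fun x => ?_⟩
  have hfun : ⇑(cutoffTensor R f - F) = fun y => (bumpPi (R⁻¹ • y) - 1) * F y := by
    funext y
    rw [sub_apply, cutoffTensor_apply hF, sub_mul, one_mul]
  rw [hfun]
  exact hC R hR x

/-- **Cut-off tensors converge in `𝓢`.** `cutoffTensor (j + 1) f → F` as `j → ∞` for every
tensor `F = ⊗ᵢ fᵢ` (Schwartz topology = the seminorm topology, `schwartz_withSeminorms`).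
[folklore] -/
theorem tendsto_cutoffTensor {f : Fin n → 𝓢(E, ℝ)} {F : 𝓢((Fin n → E), ℂ)}
    (hF : IsTensorOf F fun i => ofRealTest (f i)) :
    Tendsto (fun j : ℕ => cutoffTensor ((j : ℝ) + 1) f) atTop (𝓝 F) := by
  rw [(schwartz_withSeminorms ℂ (Fin n → E) ℂ).tendsto_nhds_atTop]
  rintro ⟨k, l⟩ ε hε
  obtain ⟨C, hC0, hC⟩ := seminorm_cutoffTensor_sub_le hF k l
  obtain ⟨j₀, hj₀⟩ := exists_nat_gt (C / ε)
  refine ⟨j₀, fun j hj => ?_⟩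
  have hj1 : (1 : ℝ) ≤ (j : ℝ) + 1 := by simp
  have hpos : (0 : ℝ) < (j : ℝ) + 1 := by positivity
  have h1 : C / ε < (j : ℝ) + 1 := hj₀.trans_le (by exact_mod_cast Nat.le_succ_of_le hj)
  have hlt : C / ((j : ℝ) + 1) < ε := by
    rw [div_lt_iff₀ hpos]
    rw [div_lt_iff₀ hε] at h1
    linarith
  exact (hC _ hj1).trans_lt hlt

end Bump

end Summit.QuantumFields.YangMills.Theorems.StrongCouplingIRTrivial

end
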